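import Mathlib
import HarnessLib
import Literature.Probability.LatticeModels.TorusFourierProofs

/-!
# Route `KLProgramme` — engine support (row (X).1 / #14 «S3 IN U-CURRENCY», NORM side, brick (T5a)): the FOURIER SUM OF A CONSERVING TRANSFER-ONLY
# QUARTIC SYMBOL over the space-time dual torus IS a pair-transfer form — model-free character algebra on `(ℤ/P)¹ × (ℤ/L)²`

Cell gate-hubbard-kl, seat hubbard-kl-k3c2-p3 (g16).  Bricks (T2)/(T2′) (`TorusFourierL2.fixedTupleL1_le_of_pairTransfer…`) take as HYPOTHESIS that a four-leg
position kernel is (majorised by) a pair-transfer form `[x₁ = x₀][x₃ = x₂]·c·|Σ_Q χ_Q(x₀ − x₂) G(Q)|`.  A producer states its quartic in MOMENTUM space: a symbol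
on four frequency–momenta that CONSERVES the total (incoming = outgoing, modulo the torus) and depends only on the TRANSFER `Q = k₀ + k₁`.  This file is the
generic identity between the two (the (s3)-class Fourier bookkeeping, done once): with the product characters `χ̄_k(z) = χ_{k₁}(z₁)χ_{k₂}(z₂)` of
`T = (ℤ/P)¹ × (ℤ/L)²` and `N = P·L²`,

  `Σ_{k₀,k₁,k₂,k₃ ∈ T} χ̄_{k₀}(−x₀) χ̄_{k₁}(−x₁) χ̄_{k₂}(x₂) χ̄_{k₃}(x₃) · [k₀ + k₁ = k₂ + k₃] · f(k₀ + k₁) = [x₁ = x₀][x₃ = x₂] · N² · Σ_Q χ̄_Q(x₀ − x₂) f(−Q)`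

(legs `0,1` carry the conjugate characters of creators `e^{-ik·x}`, legs `2,3` those of annihilators; character orthogonality twice).

* §1 `pchar_add_left`, `torusChar_neg_left'`, `pchar_neg_left`, `pchar_add_right'`, **`sum_pchar`** (orthogonality: `Σ_k χ̄_k(z) = [z = 0]·P·L²`), **`sum_pchar_mul_pchar_sub`**
  (`Σ_k χ̄_k(x) χ̄_{Q−k}(y) = χ̄_Q(y)·[x = y]·P·L²`);
* §2 `sum_pchar_ite_add_eq` (the forced fourth leg), **`fourLeg_transfer_charSum_eq`** — the identity above.

The model dictionary (plane waves of `SectorisedKernelNorm.hubbardPlaneWave` = unimodular time phase × product character; `sectorisedKernel` with the trivial multiplier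
and charges `(+,+,−,−)` of a conserving transfer-only `kernel` = pair-transfer form) is the sequel (T5b).  Everything is proved; no definitions, no named facts;
nothing here concerns a specific kernel, (X).1, K3 or superconductivity. [folklore]  References: BGM 2006 §2.1 (2.2)–(2.5), §2.3 (2.17) [cite: BenfattoGiulianiMastropietro2006];
Friedli–Velenik 2017 §10.4.
-/

noncomputable section

namespace Summit.HubbardSuperconductivity.HubbardSuperconductivity.Theorems.TorusFourierL2

set_option linter.dupNamespace false -- summit = problem name (single-conjunct summit), D-0017

open Finset Complex Literature.Probability.LatticeModels
open scoped Real ComplexConjugate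

variable {P L : ℕ} [NeZero P] [NeZero L]

/-! ### §1 Product characters of `(ℤ/P)¹ × (ℤ/L)²`: additivity and orthogonality -/

/-- Additivity in the index: `χ̄_{k+k'}(z) = χ̄_k(z)·χ̄_{k'}(z)`. [cite: FriedliVelenik2017, §10.4] -/
theorem pchar_add_left (k k' z : TorusSite 1 P × TorusSite 2 L) :
    torusChar (k + k').1 z.1 * torusChar (k + k').2 z.2 = (torusChar k.1 z.1 * torusChar k.2 z.2) * (torusChar k'.1 z.1 * torusChar k'.2 z.2) := by
  rw [Prod.fst_add, Prod.snd_add, torusChar_comm (k.1 + k'.1), torusChar_add_right, torusChar_comm (k.2 + k'.2), torusChar_add_right,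
    torusChar_comm z.1 k.1, torusChar_comm z.1 k'.1, torusChar_comm z.2 k.2, torusChar_comm z.2 k'.2]
  ring

/-- Additivity in the argument: `χ̄_k(z+z') = χ̄_k(z)·χ̄_k(z')`. [cite: FriedliVelenik2017, §10.4] -/
theorem pchar_add_right' (k z z' : TorusSite 1 P × TorusSite 2 L) :
    torusChar k.1 (z + z').1 * torusChar k.2 (z + z').2 = (torusChar k.1 z.1 * torusChar k.2 z.2) * (torusChar k.1 z'.1 * torusChar k.2 z'.2) := by
  rw [Prod.fst_add, Prod.snd_add, torusChar_add_right, torusChar_add_right]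
  ring

omit [NeZero P] in
/-- `χ_{−k}(x) = χ_k(−x)` on one torus. [cite: FriedliVelenik2017, §10.4] -/
theorem torusChar_neg_left' {d : ℕ} (k x : TorusSite d L) : torusChar (-k) x = torusChar k (-x) := by
  rw [torusChar_comm, torusChar_neg_right, torusChar_comm, ← torusChar_neg_right]

/-- Negation moves between index and argument: `χ̄_{−k}(z) = χ̄_k(−z)`. [cite: FriedliVelenik2017, §10.4] -/
theorem pchar_neg_left (k z : TorusSite 1 P × TorusSite 2 L) :
    torusChar (-k).1 z.1 * torusChar (-k).2 z.2 = torusChar k.1 (-z).1 * torusChar k.2 (-z).2 := by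
  simp only [Prod.fst_neg, Prod.snd_neg, torusChar_neg_left']

/-- **Orthogonality of the product characters**: `Σ_k χ̄_k(z) = [z = 0]·P·L²`. [cite: FriedliVelenik2017, §10.4] -/
theorem sum_pchar (z : TorusSite 1 P × TorusSite 2 L) :
    ∑ k : TorusSite 1 P × TorusSite 2 L, torusChar k.1 z.1 * torusChar k.2 z.2 = if z = 0 then ((P : ℂ) * (L : ℂ) ^ 2) else 0 := by
  classical
  rw [Fintype.sum_prod_type]
  show ∑ a : TorusSite 1 P, ∑ b : TorusSite 2 L, torusChar a z.1 * torusChar b z.2 = _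
  rw [← Finset.sum_mul_sum, sum_torusChar_left, sum_torusChar_left]
  by_cases hz : z = 0
  · rw [if_pos hz, hz, Prod.fst_zero, Prod.snd_zero, if_pos rfl, if_pos rfl, pow_one]
  · rw [if_neg hz]
    have h : z.1 ≠ 0 ∨ z.2 ≠ 0 := by
      by_contra h
      push Not at h
      exact hz (Prod.ext h.1 h.2)
    rcases h with h | h
    · rw [if_neg h, zero_mul]
    · rw [if_neg h, mul_zero]

/-- **Convolution of two characters at a fixed total index**: `Σ_k χ̄_k(x) χ̄_{Q−k}(y) = χ̄_Q(y)·[x = y]·P·L²`. [cite: FriedliVelenik2017, §10.4] -/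
theorem sum_pchar_mul_pchar_sub (Q x y : TorusSite 1 P × TorusSite 2 L) :
    ∑ k : TorusSite 1 P × TorusSite 2 L, (torusChar k.1 x.1 * torusChar k.2 x.2) * (torusChar (Q - k).1 y.1 * torusChar (Q - k).2 y.2) =
      (torusChar Q.1 y.1 * torusChar Q.2 y.2) * (if x = y then ((P : ℂ) * (L : ℂ) ^ 2) else 0) := by
  have hk : ∀ k : TorusSite 1 P × TorusSite 2 L, (torusChar k.1 x.1 * torusChar k.2 x.2) * (torusChar (Q - k).1 y.1 * torusChar (Q - k).2 y.2) =
      (torusChar Q.1 y.1 * torusChar Q.2 y.2) * (torusChar k.1 (x - y).1 * torusChar k.2 (x - y).2) := by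
    intro k
    rw [sub_eq_add_neg Q k, pchar_add_left, pchar_neg_left, sub_eq_add_neg x y, pchar_add_right']
    ring
  simp_rw [hk]
  rw [← mul_sum, sum_pchar]
  congr 1
  exact if_congr sub_eq_zero rfl rfl

/-! ### §2 The four-leg conserving transfer sum -/

/-- The fourth leg is forced by conservation: `Σ_{k₃} χ̄_{k₃}(x₃)·[k₀+k₁ = k₂+k₃]·g = χ̄_{k₀+k₁−k₂}(x₃)·g`. [folklore] -/
theorem sum_pchar_ite_add_eq (k₀ k₁ k₂ x₃ : TorusSite 1 P × TorusSite 2 L) (g : ℂ) :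
    ∑ k₃ : TorusSite 1 P × TorusSite 2 L, (torusChar k₃.1 x₃.1 * torusChar k₃.2 x₃.2) * (if k₀ + k₁ = k₂ + k₃ then g else 0) =
      (torusChar (k₀ + k₁ - k₂).1 x₃.1 * torusChar (k₀ + k₁ - k₂).2 x₃.2) * g := by
  classical
  have hiff : ∀ k₃ : TorusSite 1 P × TorusSite 2 L, (k₀ + k₁ = k₂ + k₃) ↔ (k₃ = k₀ + k₁ - k₂) := by
    intro k₃; constructor
    · intro h; rw [h]; abel
    · intro h; rw [h]; abel
  simp_rw [hiff, mul_ite, mul_zero]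
  rw [Finset.sum_ite_eq' univ (k₀ + k₁ - k₂), if_pos (mem_univ _)]

/-- **The Fourier sum of a conserving transfer-only quartic symbol is a pair-transfer form**:
`Σ_{k₀,k₁,k₂,k₃} χ̄_{k₀}(−x₀)χ̄_{k₁}(−x₁)χ̄_{k₂}(x₂)χ̄_{k₃}(x₃)·[k₀+k₁ = k₂+k₃]·f(k₀+k₁) = [x₁ = x₀][x₃ = x₂]·(P·L²)²·Σ_Q χ̄_Q(x₀ − x₂)·f(−Q)`.
[cite: BenfattoGiulianiMastropietro2006, §2.3 (2.17)] -/
theorem fourLeg_transfer_charSum_eq (f : TorusSite 1 P × TorusSite 2 L → ℂ) (x₀ x₁ x₂ x₃ : TorusSite 1 P × TorusSite 2 L) :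
    ∑ k₀ : TorusSite 1 P × TorusSite 2 L, ∑ k₁ : TorusSite 1 P × TorusSite 2 L, ∑ k₂ : TorusSite 1 P × TorusSite 2 L, ∑ k₃ : TorusSite 1 P × TorusSite 2 L,
        (torusChar k₀.1 (-x₀).1 * torusChar k₀.2 (-x₀).2) * (torusChar k₁.1 (-x₁).1 * torusChar k₁.2 (-x₁).2) *
          (torusChar k₂.1 x₂.1 * torusChar k₂.2 x₂.2) * (torusChar k₃.1 x₃.1 * torusChar k₃.2 x₃.2) *
          (if k₀ + k₁ = k₂ + k₃ then f (k₀ + k₁) else 0) =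
      if x₁ = x₀ ∧ x₃ = x₂ then (((P : ℂ) * (L : ℂ) ^ 2) ^ 2) *
        ∑ Q : TorusSite 1 P × TorusSite 2 L, (torusChar Q.1 (x₀ - x₂).1 * torusChar Q.2 (x₀ - x₂).2) * f (-Q) else 0 := by
  classical
  set N : ℂ := (P : ℂ) * (L : ℂ) ^ 2 with hN
  -- notation-free abbreviation of the product character
  set χ : (TorusSite 1 P × TorusSite 2 L) → (TorusSite 1 P × TorusSite 2 L) → ℂ := fun k z => torusChar k.1 z.1 * torusChar k.2 z.2 with hχ
  -- (1) the fourth leg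
  have h3 : ∀ k₀ k₁ k₂ : TorusSite 1 P × TorusSite 2 L,
      ∑ k₃ : TorusSite 1 P × TorusSite 2 L, χ k₀ (-x₀) * χ k₁ (-x₁) * χ k₂ x₂ * χ k₃ x₃ * (if k₀ + k₁ = k₂ + k₃ then f (k₀ + k₁) else 0) =
        χ k₀ (-x₀) * χ k₁ (-x₁) * (χ k₂ x₂ * χ (k₀ + k₁ - k₂) x₃) * f (k₀ + k₁) := by
    intro k₀ k₁ k₂
    have := sum_pchar_ite_add_eq k₀ k₁ k₂ x₃ (f (k₀ + k₁))
    simp only [hχ] at this ⊢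
    rw [show (∑ k₃ : TorusSite 1 P × TorusSite 2 L, torusChar k₀.1 (-x₀).1 * torusChar k₀.2 (-x₀).2 * (torusChar k₁.1 (-x₁).1 * torusChar k₁.2 (-x₁).2) *
        (torusChar k₂.1 x₂.1 * torusChar k₂.2 x₂.2) * (torusChar k₃.1 x₃.1 * torusChar k₃.2 x₃.2) * (if k₀ + k₁ = k₂ + k₃ then f (k₀ + k₁) else 0)) =
        torusChar k₀.1 (-x₀).1 * torusChar k₀.2 (-x₀).2 * (torusChar k₁.1 (-x₁).1 * torusChar k₁.2 (-x₁).2) * (torusChar k₂.1 x₂.1 * torusChar k₂.2 x₂.2) *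
          ∑ k₃ : TorusSite 1 P × TorusSite 2 L, (torusChar k₃.1 x₃.1 * torusChar k₃.2 x₃.2) * (if k₀ + k₁ = k₂ + k₃ then f (k₀ + k₁) else 0) by
      rw [mul_sum]; exact sum_congr rfl fun k₃ _ => by ring]
    rw [this]
    ring
  -- (2) the second pair: `Σ_{k₂} χ̄_{k₂}(x₂) χ̄_{Q−k₂}(x₃) = χ̄_Q(x₃)·[x₂ = x₃]·N`
  have h2 : ∀ k₀ k₁ : TorusSite 1 P × TorusSite 2 L,
      ∑ k₂ : TorusSite 1 P × TorusSite 2 L, χ k₀ (-x₀) * χ k₁ (-x₁) * (χ k₂ x₂ * χ (k₀ + k₁ - k₂) x₃) * f (k₀ + k₁) =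
        χ k₀ (-x₀) * χ k₁ (-x₁) * (χ (k₀ + k₁) x₃ * (if x₂ = x₃ then N else 0)) * f (k₀ + k₁) := by
    intro k₀ k₁
    rw [← sum_mul, ← mul_sum]
    congr 2
    exact sum_pchar_mul_pchar_sub (k₀ + k₁) x₂ x₃
  -- (3) the first pair, summed over `k₁` at fixed total `Q = k₀ + k₁`, then over `k₀`
  have h1 : ∑ k₀ : TorusSite 1 P × TorusSite 2 L, ∑ k₁ : TorusSite 1 P × TorusSite 2 L,
      χ k₀ (-x₀) * χ k₁ (-x₁) * (χ (k₀ + k₁) x₃ * (if x₂ = x₃ then N else 0)) * f (k₀ + k₁) =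
      ∑ Q : TorusSite 1 P × TorusSite 2 L, (χ Q (-x₁) * (if -x₀ = -x₁ then N else 0)) * (χ Q x₃ * (if x₂ = x₃ then N else 0)) * f Q := by
    -- reindex `k₁ ↦ Q = k₀ + k₁`
    have hre : ∀ k₀ : TorusSite 1 P × TorusSite 2 L,
        ∑ k₁ : TorusSite 1 P × TorusSite 2 L, χ k₀ (-x₀) * χ k₁ (-x₁) * (χ (k₀ + k₁) x₃ * (if x₂ = x₃ then N else 0)) * f (k₀ + k₁) =
          ∑ Q : TorusSite 1 P × TorusSite 2 L, χ k₀ (-x₀) * χ (Q - k₀) (-x₁) * (χ Q x₃ * (if x₂ = x₃ then N else 0)) * f Q := by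
      intro k₀
      refine Fintype.sum_equiv (Equiv.addLeft k₀) _ _ fun k₁ => ?_
      simp only [Equiv.coe_addLeft, add_sub_cancel_left]
    simp_rw [hre]
    rw [Finset.sum_comm]
    refine sum_congr rfl fun Q _ => ?_
    have hQ := sum_pchar_mul_pchar_sub Q (-x₀) (-x₁)
    simp only [hχ] at hQ ⊢
    rw [show (∑ k₀ : TorusSite 1 P × TorusSite 2 L, torusChar k₀.1 (-x₀).1 * torusChar k₀.2 (-x₀).2 * (torusChar (Q - k₀).1 (-x₁).1 * torusChar (Q - k₀).2 (-x₁).2) *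
        (torusChar Q.1 x₃.1 * torusChar Q.2 x₃.2 * (if x₂ = x₃ then N else 0)) * f Q) =
        (∑ k₀ : TorusSite 1 P × TorusSite 2 L, torusChar k₀.1 (-x₀).1 * torusChar k₀.2 (-x₀).2 * (torusChar (Q - k₀).1 (-x₁).1 * torusChar (Q - k₀).2 (-x₁).2)) *
          ((torusChar Q.1 x₃.1 * torusChar Q.2 x₃.2 * (if x₂ = x₃ then N else 0)) * f Q) by rw [sum_mul]; exact sum_congr rfl fun k₀ _ => by ring]
    rw [hQ]
    ring
  -- assemble
  have hLHS : (∑ k₀ : TorusSite 1 P × TorusSite 2 L, ∑ k₁ : TorusSite 1 P × TorusSite 2 L, ∑ k₂ : TorusSite 1 P × TorusSite 2 L,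
      ∑ k₃ : TorusSite 1 P × TorusSite 2 L,
        (torusChar k₀.1 (-x₀).1 * torusChar k₀.2 (-x₀).2) * (torusChar k₁.1 (-x₁).1 * torusChar k₁.2 (-x₁).2) *
          (torusChar k₂.1 x₂.1 * torusChar k₂.2 x₂.2) * (torusChar k₃.1 x₃.1 * torusChar k₃.2 x₃.2) *
          (if k₀ + k₁ = k₂ + k₃ then f (k₀ + k₁) else 0)) =
      ∑ k₀ : TorusSite 1 P × TorusSite 2 L, ∑ k₁ : TorusSite 1 P × TorusSite 2 L, ∑ k₂ : TorusSite 1 P × TorusSite 2 L,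
        ∑ k₃ : TorusSite 1 P × TorusSite 2 L, χ k₀ (-x₀) * χ k₁ (-x₁) * χ k₂ x₂ * χ k₃ x₃ * (if k₀ + k₁ = k₂ + k₃ then f (k₀ + k₁) else 0) := by
    simp only [hχ]
  rw [hLHS]
  simp_rw [h3, h2]
  rw [h1]
  -- the two indicator conditions and the final reindexing `Q ↦ −Q`
  by_cases hx : x₁ = x₀ ∧ x₃ = x₂
  · obtain ⟨h10, h32⟩ := hx
    have e1 : -x₀ = -x₁ := by rw [h10]
    have e2 : x₂ = x₃ := h32.symm
    rw [if_pos (show x₁ = x₀ ∧ x₃ = x₂ from ⟨h10, h32⟩)]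
    simp_rw [if_pos e1, if_pos e2]
    rw [h10, h32]
    have hre : ∑ Q : TorusSite 1 P × TorusSite 2 L, (χ Q (-x₀) * N) * (χ Q x₂ * N) * f Q =
        ∑ Q : TorusSite 1 P × TorusSite 2 L, (χ (-Q) (-x₀) * N) * (χ (-Q) x₂ * N) * f (-Q) :=
      (Fintype.sum_equiv (Equiv.neg _) (fun Q => (χ (-Q) (-x₀) * N) * (χ (-Q) x₂ * N) * f (-Q))
        (fun Q => (χ Q (-x₀) * N) * (χ Q x₂ * N) * f Q) (fun Q => by simp only [Equiv.neg_apply])).symm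
    rw [hre, mul_sum]
    refine sum_congr rfl fun Q _ => ?_
    have hprod : χ (-Q) (-x₀) * χ (-Q) x₂ = χ Q (x₀ - x₂) := by
      simp only [hχ]
      rw [pchar_neg_left, pchar_neg_left, neg_neg, sub_eq_add_neg, pchar_add_right']
    calc χ (-Q) (-x₀) * N * (χ (-Q) x₂ * N) * f (-Q) = N ^ 2 * ((χ (-Q) (-x₀) * χ (-Q) x₂) * f (-Q)) := by ring
      _ = N ^ 2 * (χ Q (x₀ - x₂) * f (-Q)) := by rw [hprod]
  · rw [if_neg hx]
    refine sum_eq_zero fun Q _ => ?_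
    by_cases h10 : x₁ = x₀
    · have h32 : ¬ x₃ = x₂ := fun h => hx ⟨h10, h⟩
      have : ¬ x₂ = x₃ := fun h => h32 h.symm
      rw [if_neg this]; ring
    · have : ¬ (-x₀ = -x₁) := fun h => h10 (neg_inj.1 h).symm
      rw [if_neg this]; ring

end Summit.HubbardSuperconductivity.HubbardSuperconductivity.Theorems.TorusFourierL2

end
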